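import Literature.NumberTheory.EllipticCurves.X049FrobeniusTraces
import Literature.NumberTheory.QuadraticFields.OmegaNegSevenHeckeSums
import Literature.NumberTheory.EllipticCurves.ComplexMultiplicationDeuringFrobeniusProofs
import Literature.NumberTheory.EllipticCurves.X049CanonicalPAdicHeightSqTwoProofs
import Literature.NumberTheory.EllipticCurves.LFunctionPrimeCoeff
import HarnessLib

/-!
# The group order formula of `X₀(49)` holds UP TO SIGN, unconditionally: `#E(𝔽_p) = p + 1 ∓ u` whenever `4p = u² + 7v²`

Topic `Literature/NumberTheory/EllipticCurves`, namespace `Literature.NumberTheory.EllipticCurves.X049` (sequel to `X049FrobeniusTraces`).  THEOREMS ONLY.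
The named fact `X049.groupOrder_A7` (Silverberg 2010 (2.1) = Rajwade 1977 Thm. 3: «if `p ≠ 7` and `4p = u² + 7v²` then
`#E(𝔽_p) = p + 1 − (2u/7)·u`» for `E = 49a1 = X₀(49)`) has exactly one piece of printed content beyond the tree: the SIGN `(2u/7)`.  This file makes
that precise by PROVING the formula up to sign from the tree's Deuring theorem `Deuring1941_frobeniusTrace_eq_add_conj_holds` (`a_p = π + π̄` for
some `π ∈ ℤ[ω₋₇]` of norm `p`, ℓ-adic proof in `ComplexMultiplicationDeuringFrobeniusProofs`) and unique factorisation in `ℤ[½(1+√−7)]`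
(`OmegaNegSeven`: the representations `4p = u² + 7v²` of a prime are `(±u, ±v)`):

* `eq_or_eq_neg_of_sq_add_seven_mul_sq` — `t² + 7b² = 4p = u² + 7v²` (`p ≠ 7` prime) forces `t = ±u`;
* ★ `numPointsMod_eq_or` — **for every prime `p ≠ 7` and `4p = u² + 7v²`: `#E(𝔽_p) = p + 1 − u` or `#E(𝔽_p) = p + 1 + u`** (proved);
* `groupOrder_A7_iff_sign` — `groupOrder_A7` is EQUIVALENT to the sign rule «`a_p(E)` is a square mod `7` whenever `4p = u² + 7v²`, `p ≠ 7`»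
  (`(a_p/7) = 1`), i.e. to Rajwade's normalisation «`π ≡ 1, 2, 4 (mod √−7)`».

Nothing about BSD is proved here.

## References
* A. Silverberg, Contemp. Math. 521 (2010), (2.1), Table 1. [Silverberg2010]
* A. R. Rajwade, J. Austral. Math. Soc. A 24 (1977), Thm. 3. [Rajwade1977]
* D. A. Cox, *Primes of the form x² + ny²*, 2nd ed. (2013), Thm. 14.16 (Deuring, `a_p = π + π̄`). [Cox2013]

## Mathlib / tree search
Tree: `Deuring1941_frobeniusTrace_eq_add_conj_holds`, `cm7`, `j_cm7`, `Δ_cm7`, `cm7_isGloballyMinimal`, `mem_cmRing_iff`, `norm_cmRing`,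
`four_mul_norm_cmRing`, `cmGen_add_conj`, `cast_minimalDiscriminantInt`, `hasGoodReductionAtPrime_of_not_dvd`, `LFunction_apply_prime_eq_frobeniusTrace`,
`X049.{E, map_E, lFunction_apply_prime, numPointsMod_two, groupOrder_A7, jacobiSym_two_mul}`, `OmegaNegSeven.{norm_mk', chi_mk, nmz, chi_nmz_eq_one, norm_nmz,
eq_or_eq_star_of_norm_eq, norm_ne_of_inert, isSquare_neg_seven, chi_eq_zero_iff_dvd_norm}`.
-/

noncomputable section

open scoped Classical NumberTheorySymbols ComplexConjugate

namespace Literature.NumberTheory.EllipticCurves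

namespace X049

open _root_.WeierstrassCurve QuadraticAlgebra Literature.NumberTheory.Automorphic Literature.NumberTheory.QuadraticFields
  Literature.NumberTheory.QuadraticFields.OmegaNegSeven

/-! ### §1 `4p = u² + 7v²` determines `u` up to sign -/

/-- `u ≡ v (mod 2)` when `u² + 7v² = 4p`. [cite: Rajwade1977, Thm 3] -/
private theorem two_dvd_sub_of_sq_add_seven_mul_sq {u v : ℤ} {p : ℕ} (h : u ^ 2 + 7 * v ^ 2 = 4 * p) : (2 : ℤ) ∣ u - v := by
  have h4 : (4 : ℤ) ∣ u ^ 2 + 7 * v ^ 2 := ⟨p, by rw [h]⟩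
  rcases Int.emod_two_eq_zero_or_one u with hu | hu <;> rcases Int.emod_two_eq_zero_or_one v with hv | hv
  · exact Int.ModEq.dvd (hv.trans hu.symm)
  · exfalso
    have : (u ^ 2 + 7 * v ^ 2) % 2 = 1 := by
      rw [Int.add_emod, pow_two, pow_two, Int.mul_emod u, Int.mul_emod 7, Int.mul_emod v, hu, hv]; decide
    omega
  · exfalso
    have : (u ^ 2 + 7 * v ^ 2) % 2 = 1 := by
      rw [Int.add_emod, pow_two, pow_two, Int.mul_emod u, Int.mul_emod 7, Int.mul_emod v, hu, hv]; decide
    omega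
  · exact Int.ModEq.dvd (hv.trans hu.symm)

/-- The element `½(u + v√−7) = (u − v)/2 + vω ∈ ℤ[ω]` attached to `u² + 7v² = 4p` has norm `p` and `2 re + im = u`. [cite: Rajwade1977, Thm 3] -/
private theorem norm_half {u v : ℤ} {p : ℕ} (h : u ^ 2 + 7 * v ^ 2 = 4 * p) :
    (⟨(u - v) / 2, v⟩ : QuadraticAlgebra ℤ (-2) 1).norm = p ∧ 2 * ((u - v) / 2) + v = u := by
  obtain ⟨t, ht⟩ := two_dvd_sub_of_sq_add_seven_mul_sq h
  have h1 : (u - v) / 2 = t := by rw [ht]; simp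
  have hu : u = 2 * t + v := by linarith
  refine ⟨?_, by rw [h1]; linarith⟩
  rw [h1, norm_mk']
  subst hu
  nlinarith [h]

/-- **`t² + 7b² = u² + 7v² = 4p` (`p ≠ 7` prime) forces `t = ±u`**: the elements `½(t + b√−7)`, `½(u + v√−7)` of `ℤ[ω]` have prime norm `p`,
so their normalised associates are `π` or `π̄` for one `π` (unique factorisation, `OmegaNegSeven.eq_or_eq_star_of_norm_eq`), and
`2 re + im` is `±t`, `±u` on them. [cite: Rajwade1977, Thm 3] -/
theorem eq_or_eq_neg_of_sq_add_seven_mul_sq {p : ℕ} (hp : p.Prime) (hp7 : p ≠ 7) {t b u v : ℤ} (h1 : t ^ 2 + 7 * b ^ 2 = 4 * p)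
    (h2 : u ^ 2 + 7 * v ^ 2 = 4 * p) : t = u ∨ t = -u := by
  obtain ⟨hα, hαℓ⟩ := norm_half h1
  obtain ⟨hβ, hβℓ⟩ := norm_half h2
  set α : QuadraticAlgebra ℤ (-2) 1 := ⟨(t - b) / 2, b⟩ with hαdef
  set β : QuadraticAlgebra ℤ (-2) 1 := ⟨(u - v) / 2, v⟩ with hβdef
  have h7 : ¬ (7 : ℤ) ∣ (p : ℤ) := fun h ↦ hp7 ((Nat.prime_dvd_prime_iff_eq (by norm_num) hp).mp (by exact_mod_cast h)).symm
  have hcα : chi α ≠ 0 := fun h0 ↦ h7 (hα ▸ (chi_eq_zero_iff_dvd_norm α).mp h0)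
  have hcβ : chi β ≠ 0 := fun h0 ↦ h7 (hβ ▸ (chi_eq_zero_iff_dvd_norm β).mp h0)
  -- the normalised associates
  have hnα : (nmz α).norm = p := by rw [norm_nmz hcα, hα]
  have hnβ : (nmz β).norm = p := by rw [norm_nmz hcβ, hβ]
  have key := eq_or_eq_star_of_norm_eq hp (chi_nmz_eq_one hcα) hnα (chi_nmz_eq_one hcβ) hnβ
  -- `2 re + im` of `nmz z = chi z · z` is `chi z · (2 re z + im z)`, and `star` preserves it
  have hℓ : ∀ z : QuadraticAlgebra ℤ (-2) 1, 2 * (nmz z).re + (nmz z).im = chi z * (2 * z.re + z.im) := by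
    intro z
    simp only [nmz, re_mul, im_mul, re_intCast, im_intCast, Int.cast_id]
    ring
  have hℓs : ∀ z : QuadraticAlgebra ℤ (-2) 1, 2 * (star z).re + (star z).im = 2 * z.re + z.im := by
    intro z
    simp only [re_star, im_star]
    ring
  have hℓα : 2 * (nmz α).re + (nmz α).im = chi α * t := by rw [hℓ, hαℓ]
  have hℓβ : 2 * (nmz β).re + (nmz β).im = chi β * u := by rw [hℓ, hβℓ]
  have heq : chi β * u = chi α * t := by
    rcases key with h | h
    · rw [← hℓβ, h, hℓα]
    · rw [← hℓβ, h, hℓs, hℓα]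
  rcases chi_trichotomy α with h0 | ha | ha
  · exact absurd h0 hcα
  · rcases chi_trichotomy β with h0 | hb | hb
    · exact absurd h0 hcβ
    · left; rw [ha, hb] at heq; linarith
    · right; rw [ha, hb] at heq; linarith
  · rcases chi_trichotomy β with h0 | hb | hb
    · exact absurd h0 hcβ
    · right; rw [ha, hb] at heq; linarith
    · left; rw [ha, hb] at heq; linarith

/-- A prime with `4p = u² + 7v²`, `p ≠ 7`, is `≡ 1, 2, 4 (mod 7)` (inert primes are not norms). [cite: Rajwade1977, Thm 3] -/
theorem mod_seven_of_sq_add_seven_mul_sq {p : ℕ} (hp : p.Prime) (hp7 : p ≠ 7) {u v : ℤ} (h : u ^ 2 + 7 * v ^ 2 = 4 * p) :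
    p % 7 = 1 ∨ p % 7 = 2 ∨ p % 7 = 4 := by
  obtain ⟨hβ, -⟩ := norm_half h
  have h0 : p % 7 ≠ 0 := fun h0 ↦ hp7 ((Nat.prime_dvd_prime_iff_eq (by norm_num) hp).mp (Nat.dvd_of_mod_eq_zero h0)).symm
  by_contra hne
  have hin : p % 7 = 3 ∨ p % 7 = 5 ∨ p % 7 = 6 := by omega
  exact norm_ne_of_inert hin _ hβ

/-! ### §2 The group order formula up to sign, from Deuring -/

/-- `E/ℚ = cm7` (the tree's name for `49a1`). [cite: Silverberg2010, Table 1] -/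
theorem map_E_eq_cm7 : E.map (Int.castRingHom ℚ) = cm7 := map_E

/-- `Δ_min(49a1) = −343`. [cite: Silverberg2010, Table 1] -/
theorem minimalDiscriminantInt_cm7 : haveI := cm7_isGloballyMinimal; minimalDiscriminantInt cm7 = -343 := by
  haveI := cm7_isGloballyMinimal
  have h := cast_minimalDiscriminantInt cm7
  rw [Δ_cm7] at h
  exact_mod_cast h

/-- **Deuring for `X₀(49)` in coordinates**: at an odd prime `p ≠ 7` with `4p = u² + 7v²` for some `u, v`, there are integers `t, b` with
`t² + 7b² = 4p` and `a_p(E) = t` (`π = ½(t + b√−7) ∈ ℤ[ω₋₇]`, `a_p = π + π̄`, `p = ππ̄`; the tree's `Deuring1941_frobeniusTrace_eq_add_conj_holds`).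
[cite: Cox2013, Thm. 14.16] -/
theorem exists_frobeniusTrace_eq_of_sq_add_seven_mul_sq {p : ℕ} (hp : p.Prime) (hp2 : p ≠ 2) (hp7 : p ≠ 7) {u v : ℤ}
    (huv : u ^ 2 + 7 * v ^ 2 = 4 * p) : ∃ t b : ℤ, t ^ 2 + 7 * b ^ 2 = 4 * p ∧ frobeniusTrace E p = t := by
  haveI := Fact.mk hp
  haveI := cm7_isGloballyMinimal
  have hj : cm7.j ∈ maximalCMJInvariants := by rw [j_cm7, maximalCMJInvariants]; decide
  have hd : cmDiscr cm7.j = -7 := by rw [j_cm7]; norm_num [cmDiscr]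
  have hΔ : ¬ (p : ℤ) ∣ minimalDiscriminantInt cm7 := by
    rw [minimalDiscriminantInt_cm7, show (-343 : ℤ) = -((7 : ℕ) : ℤ) ^ 3 by norm_num, dvd_neg]
    intro h
    have h' : (p : ℤ) ∣ (7 : ℕ) := (Nat.prime_iff_prime_int.mp hp).dvd_of_dvd_pow h
    exact hp7 ((Nat.prime_dvd_prime_iff_eq hp (by norm_num)).mp (by exact_mod_cast h'))
  have hd7 : ¬ (p : ℤ) ∣ cmDiscr cm7.j := by
    rw [hd, dvd_neg]
    intro h
    exact hp7 ((Nat.prime_dvd_prime_iff_eq hp (by norm_num)).mp (by exact_mod_cast h))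
  have hsq : IsSquare ((cmDiscr cm7.j : ℤ) : ZMod p) := by
    rw [hd]
    exact isSquare_neg_seven hp hp2 (mod_seven_of_sq_add_seven_mul_sq hp hp7 huv)
  obtain ⟨π, hπ, hππ, htr⟩ := Deuring1941_frobeniusTrace_eq_add_conj_holds cm7 hj p hp hp2 hΔ hd7 hsq
  rw [hd] at hπ
  obtain ⟨a, b, rfl⟩ := (mem_cmRing_iff (d := -7) (c := 14) (by norm_num) (by norm_num)).1 hπ
  -- `π + π̄ = 2a − 7b`, `ππ̄ = a² − 7ab + 14b²`
  have hsum : ((a : ℂ) + b * cmGen (-7)) + conj ((a : ℂ) + b * cmGen (-7)) = ((2 * a - 7 * b : ℤ) : ℂ) := by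
    have h1 := cmGen_add_conj (-7)
    simp only [map_add, map_mul, map_intCast]
    push_cast at h1 ⊢
    linear_combination (b : ℂ) * h1
  have hnorm := norm_cmRing (d := -7) (c := 14) (by norm_num) (by norm_num) a b
  rw [hnorm] at hππ
  rw [hsum] at htr
  have hp' : (a * a + a * b * (-7) + b * b * 14 : ℤ) = p := by exact_mod_cast hππ
  -- the minimal model's Frobenius trace is that of the integral model `E`
  have htrace : cm7.frobeniusTrace p = frobeniusTrace E p := by
    have hgood : cm7.HasGoodReductionAtPrime p := hasGoodReductionAtPrime_of_not_dvd cm7 p hΔ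
    rw [← LFunction_apply_prime_eq_frobeniusTrace cm7 p hgood, ← map_E_eq_cm7, lFunction_apply_prime hp hp7]
  refine ⟨2 * a - 7 * b, b, ?_, ?_⟩
  · have h4 := four_mul_norm_cmRing (d := -7) (c := 14) (by norm_num) a b
    rw [hp'] at h4
    linarith [h4]
  · rw [← htrace]; exact_mod_cast htr

/-- ★ **The group order formula of `X₀(49)` up to sign, PROVED**: for every prime `p ≠ 7` and all `u, v` with `u² + 7v² = 4p`,
`#E(𝔽_p) = p + 1 − u` or `#E(𝔽_p) = p + 1 + u` (`E = 49a1`).  (At `p = 2`: `#E(𝔽₂) = 2`, `u = ±1`.)  The printed formula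
`groupOrder_A7` picks the sign `(2u/7)`. [cite: Silverberg2010, (2.1)] [cite: Rajwade1977, Thm 3] [cite: Cox2013, Thm. 14.16] -/
theorem numPointsMod_eq_or {p : ℕ} (hp : p.Prime) (hp7 : p ≠ 7) {u v : ℤ} (huv : u ^ 2 + 7 * v ^ 2 = 4 * p) :
    (numPointsMod E p : ℤ) = p + 1 - u ∨ (numPointsMod E p : ℤ) = p + 1 + u := by
  by_cases hp2 : p = 2
  · subst hp2
    rw [numPointsMod_two]
    norm_num at huv ⊢
    have hv : v ^ 2 ≤ 1 := by nlinarith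
    have hu : u ^ 2 ≤ 8 := by nlinarith
    have hv1 : -1 ≤ v ∧ v ≤ 1 := by constructor <;> nlinarith
    have hu3 : -2 ≤ u ∧ u ≤ 2 := by constructor <;> nlinarith
    obtain ⟨hv1, hv2⟩ := hv1
    obtain ⟨hu1, hu2⟩ := hu3
    interval_cases v <;> interval_cases u <;> omega
  · obtain ⟨t, b, htb, htr⟩ := exists_frobeniusTrace_eq_of_sq_add_seven_mul_sq hp hp2 hp7 huv
    have hN : (numPointsMod E p : ℤ) = p + 1 - t := by
      have := htr; unfold Automorphic.frobeniusTrace at this; linarith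
    rcases eq_or_eq_neg_of_sq_add_seven_mul_sq hp hp7 htb huv with h | h
    · left; rw [hN, h]
    · right; rw [hN, h]; ring

/-- `(a/7) = 1` exactly on the residues `1, 2, 4`, `= −1` on `3, 5, 6`: for `a = ±u` with `7 ∤ u`, `(a/7) = 1` picks one sign.
[cite: Rajwade1977, Thm 3] -/
private theorem jacobiSym_neg_seven_arg (u : ℤ) : J(-u | 7) = -J(u | 7) := by
  rw [jacobiSym.neg _ (by decide), ZMod.χ₄_nat_three_mod_four (by norm_num)]; ring

/-- ★ **`groupOrder_A7` ⟺ the sign rule «`a_p(X₀(49))` is a square mod `7`»**: given the proved formula up to sign, Silverberg's (2.1) for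
`d = 7` is EQUIVALENT to: for every prime `p ≠ 7` with `4p = u² + 7v²`, `(a_p/7) = 1` (Rajwade's normalisation `π ≡ 1, 2, 4 (mod √−7)` of the
Frobenius `π`, `a_p = π + π̄ ≡ 2·(π mod √−7)`). [cite: Rajwade1977, Thm 3] [cite: Silverberg2010, (2.1)] -/
theorem groupOrder_A7_iff_sign :
    groupOrder_A7 ↔ ∀ (p : ℕ), p.Prime → p ≠ 7 → ∀ (u v : ℤ), u ^ 2 + 7 * v ^ 2 = 4 * p → J(frobeniusTrace E p | 7) = 1 := by
  have h7u : ∀ {p : ℕ} {u v : ℤ}, p.Prime → p ≠ 7 → u ^ 2 + 7 * v ^ 2 = 4 * p → J(u | 7) = 1 ∨ J(u | 7) = -1 := by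
    intro p u v hp hp7 huv
    rcases jacobiSym.trichotomy u 7 with h0 | h
    · exfalso
      rw [jacobiSym_seven_eq_zero_iff] at h0
      obtain ⟨hβ, hβℓ⟩ := norm_half huv
      have hchi : chi (⟨(u - v) / 2, v⟩ : QuadraticAlgebra ℤ (-2) 1) = 0 := by
        rw [chi_mk, hβℓ]; exact (jacobiSym_seven_eq_zero_iff u).mpr h0
      have h7 := (chi_eq_zero_iff_dvd_norm _).mp hchi
      rw [hβ] at h7
      exact hp7 ((Nat.prime_dvd_prime_iff_eq (by norm_num) hp).mp (by exact_mod_cast h7)).symm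
    · exact h
  constructor
  · intro hG p hp hp7 u v huv
    have h := hG p hp hp7 u v huv
    rw [jacobiSym_two_mul] at h
    have ha : frobeniusTrace E p = J(u | 7) * u := by unfold Automorphic.frobeniusTrace; linarith
    rw [ha, jacobiSym.mul_left]
    rcases h7u hp hp7 huv with h1 | h1
    · rw [h1]; norm_num
    · rw [h1]; norm_num
  · intro hS p hp hp7 u v huv
    rw [jacobiSym_two_mul]
    have hs := hS p hp hp7 u v huv
    rcases numPointsMod_eq_or hp hp7 huv with h | h
    · -- `a_p = u`, so `(u/7) = 1`
      have ha : frobeniusTrace E p = u := by unfold Automorphic.frobeniusTrace; linarith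
      rw [ha] at hs
      rw [h, hs, one_mul]
    · -- `a_p = −u`, so `(−u/7) = 1`, `(u/7) = −1`
      have ha : frobeniusTrace E p = -u := by unfold Automorphic.frobeniusTrace; linarith
      rw [ha, jacobiSym_neg_seven_arg] at hs
      have hu : J(u | 7) = -1 := by linarith
      rw [h, hu]; ring

end X049

end Literature.NumberTheory.EllipticCurves

end
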